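import Mathlib
import Summits.Ventures.HodgeRepro2.T5NormOneQuotientOrder

/-!
# Hilbert 90 at level 0 on the UNITS of a local ring with an involution — the hypothesis
  `hH90` of `T5FiltrationHilbert90` / `T5NormOneQuotientOrder` DISCHARGED

Setting: `S` a local ring, `σ : S ≃+* S` an involution, `θ ∈ S` with `θ − σ θ` a unit (the
unramified integral basis `S = R ⊕ Rθ` of the two files above).  Write `j x = x · (σ x)⁻¹` on `Sˣ`
(`conjQuot σ`).  Claim: every unit `z` with `σ z = z⁻¹` (a NORM-ONE unit) is `j x` for a UNIT `x`.

Proof (the classical explicit witness, at the unit level): if `1 + z` is a unit, `x = 1 + z` works,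
since `σ(1 + z) = 1 + z⁻¹ = z⁻¹ (1 + z)`; otherwise `1 + z` lies in the maximal ideal and
`x = θ + z · σ θ = (θ − σ θ) + (1 + z) σ θ` is a unit (a unit plus an element of the maximal ideal),
with `σ x = σ θ + z⁻¹ θ = z⁻¹ x` (here `σ ∘ σ = id` is used).  No valuation, no completeness, no
Galois cohomology.

Consequences: the capstones of rows 92 / 107 (`exists_mem_higherUnits_conjQuot_eq`,
`mem_range_conjQuotHom_iff`, `range_inf_higherUnits_eq_map`, `relIndex_range_inf_higherUnits`,
`relIndex_range_inf_higherUnits_eq` / `_two` / `_one`, `relIndex_inf_two_inf_one`) restated WITHOUT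
the hypothesis `hH90` — the three numbers `(q+1)q^{n−1}`, `(q+1)q`, `q+1`, `q` of N5.15.2 (A15) /
N5.T3 now rest on the unramified integral basis alone.

Declaration per README §8(d): «uses an L-value-free non-vanishing device: NO».
-/

namespace Summit.Ventures.HodgeRepro2.T5LocalUnitHilbert90

open T5FiltrationHilbert90 T5PrincipalUnitFiltration T5PrincipalUnitComparison

section General

variable {S : Type*} [CommRing S] (σ : S ≃+* S)

/-- The value of `conjUnits σ x` in `S` is `σ x`. -/
theorem coe_conjUnits (x : Sˣ) : ((conjUnits σ x : Sˣ) : S) = σ (x : S) := by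
  simp [conjUnits]

/-- `σ z = z⁻¹` read in `S`. -/
theorem coe_of_conjUnits_eq_inv {z : Sˣ} (hz : conjUnits σ z = z⁻¹) :
    σ (z : S) = ((z⁻¹ : Sˣ) : S) := by
  rw [← coe_conjUnits σ z, hz]

/-- If `σ x = z⁻¹ · x` then `j x = x · (σ x)⁻¹ = z`. -/
theorem conjQuot_eq_of_conjUnits_eq {x z : Sˣ} (h : conjUnits σ x = z⁻¹ * x) :
    conjQuot σ x = z := by
  simp only [conjQuot, h, mul_inv_rev, inv_inv, mul_inv_cancel_left]

/-- Case `1 + z` a unit: the witness `x = 1 + z` satisfies `σ x = z⁻¹ · x`. -/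
theorem conjUnits_one_add_eq {z : Sˣ} (hz : conjUnits σ z = z⁻¹) (h : IsUnit ((1 : S) + z)) :
    conjUnits σ h.unit = z⁻¹ * h.unit := by
  apply Units.ext
  have hz' := coe_of_conjUnits_eq_inv σ hz
  have hinv : ((z⁻¹ : Sˣ) : S) * (z : S) = 1 := Units.inv_mul z
  simp only [coe_conjUnits, IsUnit.unit_spec, Units.val_mul, map_add, map_one, hz']
  linear_combination (-1 : S) * hinv

/-- Case `1 + z` NOT a unit: `x = θ + z · σ θ` is a unit (it is `(θ − σ θ) + (1 + z) σ θ`, a unit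
plus an element of the maximal ideal). -/
theorem isUnit_add_mul_conj [IsLocalRing S] {θ : S} (hθ : IsUnit (θ - σ θ)) {z : Sˣ}
    (h : ¬ IsUnit ((1 : S) + z)) : IsUnit (θ + (z : S) * σ θ) := by
  by_contra hx
  have hm : ∀ a : S, ¬ IsUnit a → a ∈ IsLocalRing.maximalIdeal S := fun a ha =>
    (IsLocalRing.mem_maximalIdeal a).2 (mem_nonunits_iff.2 ha)
  have h1 : θ - σ θ = (θ + (z : S) * σ θ) - ((1 : S) + z) * σ θ := by ring
  have h2 : θ - σ θ ∈ IsLocalRing.maximalIdeal S := by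
    rw [h1]
    exact Ideal.sub_mem _ (hm _ hx) (Ideal.mul_mem_right _ _ (hm _ h))
  exact (mem_nonunits_iff.1 ((IsLocalRing.mem_maximalIdeal _).1 h2)) hθ

/-- Case `1 + z` NOT a unit: the witness `x = θ + z · σ θ` satisfies `σ x = z⁻¹ · x`
(uses `σ ∘ σ = id`). -/
theorem conjUnits_add_mul_conj_eq (hσσ : ∀ s, σ (σ s) = s) {θ : S} {z : Sˣ}
    (hz : conjUnits σ z = z⁻¹) (hx : IsUnit (θ + (z : S) * σ θ)) :
    conjUnits σ hx.unit = z⁻¹ * hx.unit := by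
  apply Units.ext
  have hz' := coe_of_conjUnits_eq_inv σ hz
  have hinv : ((z⁻¹ : Sˣ) : S) * (z : S) = 1 := Units.inv_mul z
  simp only [coe_conjUnits, IsUnit.unit_spec, Units.val_mul, map_add, map_mul, hσσ, hz']
  linear_combination (-(σ θ)) * hinv

/-- **Hilbert 90 at level 0 on the units of a local ring**: `σ` an involution of the local ring `S`,
`θ − σ θ` a unit; every unit `z` with `σ z = z⁻¹` is `j x = x · (σ x)⁻¹` for a unit `x`. -/
theorem exists_conjQuot_eq [IsLocalRing S] (hσσ : ∀ s, σ (σ s) = s) {θ : S}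
    (hθ : IsUnit (θ - σ θ)) (z : Sˣ) (hz : conjUnits σ z = z⁻¹) :
    ∃ x : Sˣ, conjQuot σ x = z := by
  by_cases h : IsUnit ((1 : S) + z)
  · exact ⟨h.unit, conjQuot_eq_of_conjUnits_eq σ (conjUnits_one_add_eq σ hz h)⟩
  · have hx := isUnit_add_mul_conj σ hθ h
    exact ⟨hx.unit, conjQuot_eq_of_conjUnits_eq σ (conjUnits_add_mul_conj_eq σ hσσ hz hx)⟩

/-- The hypothesis `hH90` of `T5FiltrationHilbert90.exists_mem_higherUnits_conjQuot_eq` and of the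
`T5NormOneQuotientOrder` capstones, in exactly its registered shape. -/
theorem hilbert90_units [IsLocalRing S] (hσσ : ∀ s, σ (σ s) = s) {θ : S}
    (hθ : IsUnit (θ - σ θ)) :
    ∀ z : Sˣ, conjUnits σ z = z⁻¹ → ∃ x, conjQuot σ x = z :=
  fun z hz => exists_conjQuot_eq σ hσσ hθ z hz

/-- The norm-one units are EXACTLY the range of `j` (Hilbert 90 in subgroup form, unit level). -/
theorem range_conjQuotHom_eq [IsLocalRing S] (hσσ : ∀ s, σ (σ s) = s) {θ : S}
    (hθ : IsUnit (θ - σ θ)) :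
    ((MonoidHom.mk' (conjQuot σ) (conjQuot_mul σ)).range : Set Sˣ) =
      {z : Sˣ | conjUnits σ z = z⁻¹} := by
  ext z
  exact T5NormOneQuotientOrder.mem_range_conjQuotHom_iff σ hσσ (hilbert90_units σ hσσ hθ) z

end General

section Discharged

variable {R S : Type*} [CommRing R] [CommRing S] [Algebra R S] (σ : S ≃+* S)

/-- Row 92's capstone without `hH90`: a norm-one unit in `U^n` is `j x` with `x ∈ U^n`. -/
theorem exists_mem_higherUnits_conjQuot_eq [IsLocalRing S] [IsLocalHom (algebraMap R S)]
    (hσR : ∀ r : R, σ (algebraMap R S r) = algebraMap R S r) (hσσ : ∀ s, σ (σ s) = s)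
    {θ : S} (hθ : IsUnit (θ - σ θ))
    (hbasis : ∀ s : S, ∃ a b : R, s = algebraMap R S a + algebraMap R S b * θ) {ϖ : R}
    (hϖ : algebraMap R S ϖ ∈ IsLocalRing.maximalIdeal S) (n : ℕ) (z : Sˣ)
    (hz : conjUnits σ z = z⁻¹) (hzn : z ∈ higherUnits (algebraMap R S ϖ) n) :
    ∃ x ∈ higherUnits (algebraMap R S ϖ) n, conjQuot σ x = z :=
  T5FiltrationHilbert90.exists_mem_higherUnits_conjQuot_eq σ hσR hθ hbasis hϖ
    (hilbert90_units σ hσσ hθ) n z hz hzn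

/-- Row 107's `E¹ ∩ U^n = j(U^n)` without `hH90`. -/
theorem range_inf_higherUnits_eq_map [IsLocalHom (algebraMap R S)] [IsLocalRing S]
    (hσR : ∀ r : R, σ (algebraMap R S r) = algebraMap R S r) (hσσ : ∀ s, σ (σ s) = s)
    {θ : S} (hθ : IsUnit (θ - σ θ))
    (hbasis : ∀ s : S, ∃ a b : R, s = algebraMap R S a + algebraMap R S b * θ) {ϖ : R}
    (hϖ : algebraMap R S ϖ ∈ IsLocalRing.maximalIdeal S) (n : ℕ) :
    (MonoidHom.mk' (conjQuot σ) (conjQuot_mul σ)).range ⊓ higherUnits (algebraMap R S ϖ) n =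
      Subgroup.map (MonoidHom.mk' (conjQuot σ) (conjQuot_mul σ))
        (higherUnits (algebraMap R S ϖ) n) :=
  T5NormOneQuotientOrder.range_inf_higherUnits_eq_map σ hσR hσσ hθ hbasis hϖ
    (hilbert90_units σ hσσ hθ) n

/-- Row 107's `[E¹ : E¹ ∩ U^n] = [U_E : U_F U_E^n]` without `hH90`. -/
theorem relIndex_range_inf_higherUnits [IsLocalHom (algebraMap R S)] [IsLocalRing S]
    (hσR : ∀ r : R, σ (algebraMap R S r) = algebraMap R S r) (hσσ : ∀ s, σ (σ s) = s)
    {θ : S} (hθ : IsUnit (θ - σ θ))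
    (hbasis : ∀ s : S, ∃ a b : R, s = algebraMap R S a + algebraMap R S b * θ) {ϖ : R}
    (hϖ : algebraMap R S ϖ ∈ IsLocalRing.maximalIdeal S) (n : ℕ) :
    ((MonoidHom.mk' (conjQuot σ) (conjQuot_mul σ)).range ⊓
        higherUnits (algebraMap R S ϖ) n).relIndex
        (MonoidHom.mk' (conjQuot σ) (conjQuot_mul σ)).range =
      ((unitsMap (R := R) (S := S)).range ⊔ higherUnits (algebraMap R S ϖ) n).index :=
  T5NormOneQuotientOrder.relIndex_range_inf_higherUnits σ hσR hσσ hθ hbasis hϖ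
    (hilbert90_units σ hσσ hθ) n

variable [IsDomain R] [IsDomain S] [IsDiscreteValuationRing R] [IsDiscreteValuationRing S]
  [IsLocalHom (algebraMap R S)]

/-- N5.15.2 (A15) / N5.T3: `[E¹ : E¹ ∩ U^n] = (q+1)q^{n−1}` (`n ≥ 1`) without `hH90`. -/
theorem relIndex_range_inf_higherUnits_eq
    (hσR : ∀ r : R, σ (algebraMap R S r) = algebraMap R S r) (hσσ : ∀ s, σ (σ s) = s)
    {θ : S} (hθ : IsUnit (θ - σ θ))
    (hbasis : ∀ s : S, ∃ a b : R, s = algebraMap R S a + algebraMap R S b * θ)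
    (hinj : Function.Injective (algebraMap R S)) {ϖ : R} (hϖ : Irreducible ϖ)
    (hϖS : Irreducible (algebraMap R S ϖ)) {q : ℕ} (hq : 2 ≤ q)
    (hR : Nat.card (IsLocalRing.ResidueField R) = q)
    (hRu : Nat.card (IsLocalRing.ResidueField R)ˣ = q - 1)
    (hS : Nat.card (IsLocalRing.ResidueField S) = q ^ 2)
    (hSu : Nat.card (IsLocalRing.ResidueField S)ˣ = q ^ 2 - 1) {n : ℕ} (hn : 1 ≤ n) :
    ((MonoidHom.mk' (conjQuot σ) (conjQuot_mul σ)).range ⊓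
        higherUnits (algebraMap R S ϖ) n).relIndex
        (MonoidHom.mk' (conjQuot σ) (conjQuot_mul σ)).range = (q + 1) * q ^ (n - 1) :=
  T5NormOneQuotientOrder.relIndex_range_inf_higherUnits_eq σ hσR hσσ hθ hbasis hinj hϖ hϖS
    (hilbert90_units σ hσσ hθ) hq hR hRu hS hSu hn

/-- `|E¹/(E¹ ∩ U²)| = (q+1)q` without `hH90`. -/
theorem relIndex_range_inf_higherUnits_two
    (hσR : ∀ r : R, σ (algebraMap R S r) = algebraMap R S r) (hσσ : ∀ s, σ (σ s) = s)
    {θ : S} (hθ : IsUnit (θ - σ θ))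
    (hbasis : ∀ s : S, ∃ a b : R, s = algebraMap R S a + algebraMap R S b * θ)
    (hinj : Function.Injective (algebraMap R S)) {ϖ : R} (hϖ : Irreducible ϖ)
    (hϖS : Irreducible (algebraMap R S ϖ)) {q : ℕ} (hq : 2 ≤ q)
    (hR : Nat.card (IsLocalRing.ResidueField R) = q)
    (hRu : Nat.card (IsLocalRing.ResidueField R)ˣ = q - 1)
    (hS : Nat.card (IsLocalRing.ResidueField S) = q ^ 2)
    (hSu : Nat.card (IsLocalRing.ResidueField S)ˣ = q ^ 2 - 1) :
    ((MonoidHom.mk' (conjQuot σ) (conjQuot_mul σ)).range ⊓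
        higherUnits (algebraMap R S ϖ) 2).relIndex
        (MonoidHom.mk' (conjQuot σ) (conjQuot_mul σ)).range = (q + 1) * q :=
  T5NormOneQuotientOrder.relIndex_range_inf_higherUnits_two σ hσR hσσ hθ hbasis hinj hϖ hϖS
    (hilbert90_units σ hσσ hθ) hq hR hRu hS hSu

/-- `|G/G¹| = |E¹/(E¹ ∩ U¹)| = q + 1` without `hH90`. -/
theorem relIndex_range_inf_higherUnits_one
    (hσR : ∀ r : R, σ (algebraMap R S r) = algebraMap R S r) (hσσ : ∀ s, σ (σ s) = s)
    {θ : S} (hθ : IsUnit (θ - σ θ))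
    (hbasis : ∀ s : S, ∃ a b : R, s = algebraMap R S a + algebraMap R S b * θ)
    (hinj : Function.Injective (algebraMap R S)) {ϖ : R} (hϖ : Irreducible ϖ)
    (hϖS : Irreducible (algebraMap R S ϖ)) {q : ℕ} (hq : 2 ≤ q)
    (hR : Nat.card (IsLocalRing.ResidueField R) = q)
    (hRu : Nat.card (IsLocalRing.ResidueField R)ˣ = q - 1)
    (hS : Nat.card (IsLocalRing.ResidueField S) = q ^ 2)
    (hSu : Nat.card (IsLocalRing.ResidueField S)ˣ = q ^ 2 - 1) :
    ((MonoidHom.mk' (conjQuot σ) (conjQuot_mul σ)).range ⊓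
        higherUnits (algebraMap R S ϖ) 1).relIndex
        (MonoidHom.mk' (conjQuot σ) (conjQuot_mul σ)).range = q + 1 :=
  T5NormOneQuotientOrder.relIndex_range_inf_higherUnits_one σ hσR hσσ hθ hbasis hinj hϖ hϖS
    (hilbert90_units σ hσσ hθ) hq hR hRu hS hSu

/-- `|G¹| = |(E¹ ∩ U¹)/(E¹ ∩ U²)| = q` without `hH90`. -/
theorem relIndex_inf_two_inf_one
    (hσR : ∀ r : R, σ (algebraMap R S r) = algebraMap R S r) (hσσ : ∀ s, σ (σ s) = s)
    {θ : S} (hθ : IsUnit (θ - σ θ))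
    (hbasis : ∀ s : S, ∃ a b : R, s = algebraMap R S a + algebraMap R S b * θ)
    (hinj : Function.Injective (algebraMap R S)) {ϖ : R} (hϖ : Irreducible ϖ)
    (hϖS : Irreducible (algebraMap R S ϖ)) {q : ℕ} (hq : 2 ≤ q)
    (hR : Nat.card (IsLocalRing.ResidueField R) = q)
    (hRu : Nat.card (IsLocalRing.ResidueField R)ˣ = q - 1)
    (hS : Nat.card (IsLocalRing.ResidueField S) = q ^ 2)
    (hSu : Nat.card (IsLocalRing.ResidueField S)ˣ = q ^ 2 - 1) :
    ((MonoidHom.mk' (conjQuot σ) (conjQuot_mul σ)).range ⊓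
        higherUnits (algebraMap R S ϖ) 2).relIndex
        ((MonoidHom.mk' (conjQuot σ) (conjQuot_mul σ)).range ⊓
          higherUnits (algebraMap R S ϖ) 1) = q :=
  T5NormOneQuotientOrder.relIndex_inf_two_inf_one σ hσR hσσ hθ hbasis hinj hϖ hϖS
    (hilbert90_units σ hσσ hθ) hq hR hRu hS hSu

end Discharged

end Summit.Ventures.HodgeRepro2.T5LocalUnitHilbert90
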